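import Literature.AlgebraicGeometry.HodgeTheory.GysinFormalism
import Literature.AlgebraicGeometry.HodgeTheory.RationalHodgeClasses
import Literature.AlgebraicGeometry.Motives.FamiliesVHS
import Literature.AlgebraicGeometry.Motives.AbelianVariety
import Literature.AlgebraicTopology.SingularHomology.GysinMap
import Literature.Geometry.Kaehler.LefschetzOperator
import HarnessLib

/-!
# André's motivated classes on complex Betti cohomology: the Lefschetz involution `⋆_L`, polarisation classes, correspondences acting through the topological Gysin map, `A(X)`/`B(X)` and Theorems 0.5 / 0.6.2 on the real carriers

Family `hodge`, layer `Literature/AlgebraicGeometry/HodgeTheory`. Y. André, *Pour une théorie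
inconditionnelle des motifs*, Publ. Math. IHÉS 83 (1996), defines the **motivated cycles** of a smooth
projective `X` as the classes `pr_{X*}(α ∪ *_L β)`, `α`, `β` algebraic on `X × Y`, `*_L` the Lefschetz
involution of a polarisation of `X × Y` (Déf. 1), proves that they deform along flat families
UNCONDITIONALLY (Thm. 0.5), that Hodge classes on abelian varieties are motivated (Thm. 0.6.2), and
remarks that they ARE algebraic as soon as the Lefschetz involutions are (conjecture `B`). The tree has
this theory over an ABSTRACT Weil cohomology `W` (`Motives/MotivatedCycles`,
`Motives/MotivatedCyclesProduct`, `Motives/StandardConjectureA`; the barrier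
`Barriers/HodgeConjecture/MotivatedClassesAbelianVarieties` is a predicate on an abstract Betti–Hodge
datum `B`, whose universal closure is refuted there), so that no CLOSED statement about complex
varieties could be written with it. This file puts the notions on the REAL carriers of the summit
statement — `complexBetti X k = Hᵏ(X(ℂ); ℂ)`, `algebraicClasses X p = Nᵖ H²ᵖ`, `IsRationalClass`,
`IsOfHodgeType` (`HodgeTheory/{AlgebraicClasses, RationalHodgeClasses}`), the tree's Alexander–Whitney
cup product `cupProduct` and ITS Lefschetz operator `Literature.Geometry.Kaehler.lefschetzPow κ j k`,
`HasHardLefschetzProperty κ n` (`Geometry/Kaehler/LefschetzOperator`, imported, not redefined), and the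
tree's topological Gysin homomorphism `gysinMap μY μX f = D_X⁻¹ ∘ f_* ∘ D_Y` of `ℂ`-oriented manifolds
(`AlgebraicTopology/SingularHomology/GysinMap`). Sources read, verbatim:

* André 1996, §0.2 (p. 7): "l'involution « de Lefschetz » `*_L`, donnée en chaque degré par
  l'isomorphisme de Lefschetz ou son inverse (§ 1)"; §0.3 (pp. 7–8): "cette notion se réduit à celle
  de cycle algébrique si pour tout objet de `𝒱` l'involution `*_L` est donnée par une correspondance
  algébrique"; §1.1 (p. 10): "Soit `X` un `K`-schéma projectif lisse purement de dimension `d`, muni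
  de la classe `η = c₁(𝓛_X) ∈ H²(X)` d'un faisceau inversible ample `𝓛_X`, et soit `L = L_η`
  l'opérateur de Lefschetz sur `H(X)` défini par le cup-produit avec `η`. On dit que `X` vérifie le
  théorème de Lefschetz fort […] si pour tout `i ≤ d`, `L^{d-i} : Hⁱ(X) → H^{2d-i}(X)` est un
  isomorphisme. […] si `x = Σ Lᵏ x_{j-2k}` est la décomposition de Lefschetz de `x ∈ Hʲ(X)` […]
  `*_L x = Σ L^{d-j+k} x_{j-2k}`"; Prop. 1.2 (p. 11): "Les sous-algèbres `ℚ[L, *_L]`, `ℚ[L, *_H]`,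
  `ℚ[L, ᶜΛ]`, `ℚ[L, Λ]` de `End H(X)` sont égales et contiennent les projecteurs de Künneth";
  §2.1 Déf. 1 (p. 14): "Un cycle motivé sur `X` à coefficients dans `E` est un élément de `H(X)` de la
  forme `pr^{XY}_{X*}(α ∪ * β)`, où : `α` et `β` sont des cycles algébriques à coefficients dans `E`
  sur `X × Y`, avec `Y` arbitraire dans `𝒱`, `* = *_{X×Y}` est relative à
  `η_{X×Y} = [X] ⊗ η_Y + η_X ⊗ [Y]`, `η_X` (resp. `η_Y`) désignant la classe d'un quelconque faisceau
  inversible ample sur `X` (resp. `Y`). Notons `A_mot(X)_E` […] l'ensemble des cycles motivés sur `X`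
  à coefficients dans `E`. Il est clair que `A_mot(X)_E` contient `A(X)` et `*A(X)` […], et que
  `A_mot(X) = A(X)` si pour tout schéma `Y` dans `𝒱`, polarisé, l'involution de Lefschetz est donnée
  par une correspondance algébrique"; Prop. 2.1 (p. 14): "(i) `A_mot(X)_E` est une sous-`E`-algèbre de
  `H(X)`"; Prop. 2.2 Cor. 1 (p. 16): "`A_mot(X)_E` est stable sous `*` et ne change pas si dans la
  définition on échange `*_L` avec `*_H` (ou plus généralement tout opérateur qui est proportionnel à
  `*_L` sur chaque composante de Lefschetz)"; §3.2 Remarque (p. 21): "pour toute autre polarisation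
  `η'_X`, l'involution `*_{L'}` associée appartient à `C_mot(X, X)_ℚ` […]. Puisque
  `*_{L'} = Σᵢ (L'^{d-i})^{±1} πⁱ`, il suffit d'établir que `(L'^{d-i})⁻¹|_{H^{2d-i}(X)} ∈ C_mot(X, X)_ℚ`
  pour tout `i > d`. Ceci découle de ce que […] s'exprime comme polynôme à coefficients dans `ℚ` en
  `πⁱ (L')^{d-i} *_L π^{2d-i}` (Cayley–Hamilton et prop. précédente)"; Prop. 3.2.1, Prop. 3.3
  (`Q = ℚ`, `A_mot(X)_ℚ ⊗ E = A_mot(X)_E`); §2.5 c) and Prop. 2.5.1 (motivated classes are of type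
  `(0,0)`, absolute Hodge); Thm. 0.5 (p. 8) and §5.1 (p. 25); Thm. 0.6.2 (p. 9) and §6.3 (p. 31) —
  quoted on the declarations.
* A. Grothendieck, *Standard conjectures on algebraic cycles* (Bombay 1968), §3 p. 196: `A(X)` (a) "`∪
  ξⁿ⁻ⁱ : Hⁱ(X) → H²ⁿ⁻ⁱ(X)` […] is always an isomorphism (the mild form)", (b) "if `i = 2j`, it induces
  an isomorphism (or equivalently, an epimorphism) `Cʲ(X) → Cⁿ⁻ʲ(X)`"; `B(X)`: "the `Λ`-operation of
  Hodge theory is algebraic"; "`B(X) ⇒ A(X)` […] `A(X × X) ⇒ B(X)`" (abstract rendering: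
  `Motives.WeilCohomology.StandardConjectureA`, file `Motives/StandardConjectureA`, mirrored here).
* C. Voisin, *Hodge Theory and Complex Algebraic Geometry I* (2002), Thm. 6.25 (hard Lefschetz) with
  Rem. 6.27, §7.1.2 ("When the class `[ω]` is integral … the operator `L` acts on the integral
  cohomology"), §7.3.2 (Gysin morphism via Poincaré duality), §11.1.2, §11.3.3 Lemma 11.41; *II* (2003),
  proof of Lemma 9.18 ("the class `[Z]` of a cycle `Z` vanishes on `X – Supp Z`"), proof of Thm. 10.17,
  (10.7) "`α_r^*(β) = pr_{1*}(pr_2^*(β) ∪ α)`", Prop. 9.20–9.21.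
* W. Fulton, *Young Tableaux* (1997), App. B §B.1 (4)–(5); A. Hatcher, *Algebraic Topology* (2002),
  Thm. 3.30, §3.3 pp. 233–236 (orientations).

## Content

* `complexBetti.degCast X h : Hᵃ ≃ₗ Hᵇ` (`h : a = b`) — degree transport, bookkeeping only.
* `IsPolarizationClass n X η` — **polarisation class**: `η ∈ H²(X(ℂ); ℂ)` rational, supported on a
  divisor (`η ∈ N¹ H²`), with the hard Lefschetz property in dimension `n` — the polarisation-type
  fields of the tree's `HardLefschetzThreefold`, in any dimension. Intended: André's `η = c₁(𝓛_X)`,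
  `𝓛_X` ample, i.e. `[H]` (integral, Voisin I §7.1.2/§11.1.2; supported on `H`, Voisin II proof of
  Lemma 9.18; hard Lefschetz, Voisin I Thm. 6.25). A priori WIDER than "class of an ample sheaf"
  (`-[H]` qualifies); harmless, see "Faithfulness" below.
* `lefschetzInvolution hL hab : Hᵃ →ₗ Hᵇ` (`a + b = 2d`) — **André's `*_L`, CONSTRUCTED**: `L^{d-a}` on
  `Hᵃ` for `a ≤ d`, the inverse of `L^{d-b} : Hᵇ → Hᵃ` for `a > d` ("donnée en chaque degré par
  l'isomorphisme de Lefschetz ou son inverse"; for `x = Σₖ Lᵏ x_{j-2k} ∈ Hʲ`, `j ≤ d`, André's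
  `*_L x = Σₖ L^{d-j+k} x_{j-2k} = L^{d-j} x`). No Lefschetz decomposition is needed. Proved: the two
  defining formulas, `*_L ∘ *_L = id` in both orders, bijectivity.
* `corrClassAction μ ν hab hq γ` — the action `γ^*(c) = pr_{W*}(pr_X^* c ∪ γ) : Hᵃ(X(ℂ)) → Hᵇ(W(ℂ))` of
  a class `γ ∈ H^{2e}((W ⊗ X)(ℂ))` (Voisin II (10.7)), CONSTRUCTED relative to `ℂ`-orientations `μ` of
  `(W ⊗ X)(ℂ)`, `ν` of `W(ℂ)` with `pr_{W*} = gysinMap μ ν pr_W(ℂ)` (the tree's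
  `GysinFormalism.corrClassGen` with the hypothesis-structure Gysin map replaced by the topological
  one); `IsAlgebraicCorrespondence m n W X T` — `T` is `γ^*` for an ALGEBRAIC `γ` and some orientations
  with Poincaré duality.
* `StandardConjectureA n X η`, `StandardConjectureBStar n X η` — OPEN CONJECTURES [status: open]:
  Grothendieck's `A(X)` ((a) ∧ (b), `Cᵖ ⊗ ℂ = algebraicClasses X p`) and `B(X)` in André's form "`*_L`
  is given by an algebraic correspondence" (⟺ "`Λ` algebraic" by Prop. 1.2).
* `IsMotivatedClass n X p x`, `motivatedClasses n X p` — **André's motivated classes `A_motᵖ(X)_ℂ`**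
  (Déf. 1) as the `ℂ`-span in `H²ᵖ(X(ℂ); ℂ)` of the `pr_{X*}(α ∪ *_L β)`.
* Named facts (D-0014): `Andre1996_motivatedClasses_le_algebraicClasses_of_standardConjectureB`
  (§2.1 remark: `B` ⇒ `A_mot ⊆ A`), `Andre1996_deformation` (Thm. 0.5, global-class form),
  `Andre1996_hodgeClasses_abelianVariety_motivated` (Thm. 0.6.2).

## Faithfulness of the span (what a reviewer must accept)

`motivatedClasses n X p` is André's `A_motᵖ(X)_ℂ` for `H = H_B(–, ℚ) ⊗ ℂ` (§2.5 c)) modelled on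
`𝒱` = all smooth projective complex varieties, up to four renderings none of which changes the SPAN:
(i) polarisations: any `IsPolarizationClass` of `X ⊗ Y` instead of the product of ample classes —
André §3.2 Remarque with Prop. 1.2/Cayley–Hamilton: `*_{L'}` of any other polarisation is degreewise a
`ℚ`-polynomial in the algebraic `L'` and `*_L`, hence a motivated correspondence, so the spaces
`A_mot(X)_E` "ne dépend[e]nt donc pas du choix des polarisations" (the argument uses of `η'` only that
`L_{η'}` is algebraic and hard Lefschetz holds, i.e. our fields); (ii) orientations: `pr_{X*}` needs
Poincaré duality, hence an orientation of `X(ℂ)` and of `(X ⊗ Y)(ℂ)`; the complex orientation is not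
yet constructed in the tree (`HodgeTheory/ComplexGysin` works relative to an `OrientationFamily`), so
the generators quantify over `ℂ`-orientations with Poincaré duality — on the CONNECTED closed
manifolds `X(ℂ)`, `(X ⊗ Y)(ℂ)` (`IsSmoothProjective` is geometrically irreducible) these are the
`ℂˣ`-multiples of the complex ones (unique continuation of local orientations, Hatcher pp. 234–235),
under which `gysinMap` rescales by a non-zero constant; (iii) `Y` connected: a generator with
`Y = Y₁ ⊔ Y₂` is the sum of those with `Y₁`, `Y₂`; (iv) `E = ℂ` and `A(X × Y)_ℂ = Nᵃ H²ᵃ` (coniveau =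
span of cycle classes by purity, the standing identification of `HodgeTheory/AlgebraicClasses`). By
Prop. 3.2.1/3.3, `A_mot(X)_ℂ = A_mot(X)_ℚ ⊗ ℂ`.

## Relation to the abstract layer

`Motives/Lefschetz` introduces Kleiman's `⋆` RELATIONALLY (`IsLefschetzStar`: `⋆ (Lʲ x) =
(-1)^{i(i+1)/2} Lⁿ⁻ⁱ⁻ʲ x` on `Pⁱ`), existence/uniqueness being named facts; André's `*_L` has no sign
(`L^{d-i-j}` on `Lʲ Pⁱ`), Kleiman's `⋆ = ± *_L` on each Lefschetz component gives the same `A_mot`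
(Prop. 2.2 Cor. 1). `Motives/MotivatedCycles` characterises `pr_{X*}` by the projection formula against
`W.trace`; here `pr_{X*}` is the tree's `gysinMap`.

## Design and what is NOT here

* Degrees: explicit equations (`a + b = 2 * d`, `b + b' = n + m`, `a + b' = p + m`, `p + q = n`), as on
  the whole layer; inside `lefschetzInvolution` the exponent `d - a` (resp. `d - b`) sits under the
  branch hypothesis `a ≤ d` (resp. `b < d`) and never truncates.
* Not here (theorems, for proving seats): `A(X) ⊆ A_mot(X)` ("il est clair" — needs an orientation of
  `X(ℂ)` with Poincaré duality, a polarisation class of `X`, and the top-degree algebraicity of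
  `HodgeTheory/TopDegreeClasses`), `A_mot` a subalgebra stable under `f^*`, `f_*` (Prop. 2.1), hard
  Lefschetz for product polarisations (§1.3), the existence of polarisation classes (hard Lefschetz
  theorem) and of `ℂ`-orientations of `X(ℂ)` (complex manifolds are orientable); discharges of the
  three named facts (Thm. 0.5 = André's motivic reading of Deligne's theorem of the fixed part;
  Thm. 0.6.2 = §6 of the paper).
* Mathlib has no Lefschetz operator, standard conjectures, Gysin maps or motivated cycles (searched
  `Lefschetz`, `motivated`, `gysin`, `standardConjecture`); all carriers are the tree's.

## References

* [Andre1996Motifs] Y. André, Publ. Math. IHÉS 83 (1996) 5–49: §0.2–0.3, 0.5, 0.6.2, §1.1, Prop. 1.2,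
  §1.3, §2.1 (Déf. 1, Prop. 2.1), Prop. 2.2 Cor. 1, §2.5, §3.2 Remarque, Prop. 3.2.1, 3.3, §5.1, §6.3.
* [Grothendieck1968] A. Grothendieck, Standard conjectures on algebraic cycles (Bombay 1968), §3 p. 196.
* [Kleiman1968] S. Kleiman, Algebraic cycles and the Weil conjectures, §1.4 (1.4.2), §2.
* [VoisinHodgeI2002] C. Voisin, Hodge Theory and Complex Algebraic Geometry I: Thm. 6.25, Rem. 6.27,
  §7.1.2, §7.3.2, §11.1.2, §11.3.3 Lemma 11.41.
* [VoisinHodgeII2003] C. Voisin, Hodge Theory and Complex Algebraic Geometry II: proof of Lemma 9.18,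
  Prop. 9.20, Prop. 9.21, proof of Thm. 10.17 (10.7).
* [FultonYoungTableaux1997] W. Fulton, Young Tableaux, App. B §B.1 (4)–(5).
* [HatcherAT2002] A. Hatcher, Algebraic Topology, §3.3 Thm. 3.30, pp. 233–236.
* [DeligneHodgeII1971] P. Deligne, Théorie de Hodge II, 4.1.1 (theorem of the fixed part).
-/

noncomputable section

open CategoryTheory AlgebraicGeometry MonoidalCategory CartesianMonoidalCategory
open Literature.AlgebraicTopology.SingularHomology Literature.Geometry.Kaehler

namespace Literature.AlgebraicGeometry.HodgeTheory

section HodgeTheory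

variable {X : Motives.SchemeOver ℂ}

/-! ### Degree transport -/

variable (X) in
/-- Transport `Hᵃ(X(ℂ); ℂ) ≃ₗ[ℂ] Hᵇ(X(ℂ); ℂ)` along an equality of degrees `h : a = b` (the identity map
whenever the two degree expressions agree definitionally; a bookkeeping device for the degree
equations of this layer, no mathematical content). [folklore] -/
def complexBetti.degCast {a b : ℕ} (h : a = b) : complexBetti X a ≃ₗ[ℂ] complexBetti X b :=
  h ▸ LinearEquiv.refl ℂ (complexBetti X a)

/-- Transport along `rfl` is the identity. [folklore] -/
@[simp]
theorem complexBetti.degCast_rfl {a : ℕ} (x : complexBetti X a) :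
    complexBetti.degCast X (rfl : a = a) x = x :=
  rfl

/-- Transports compose. [folklore] -/
@[simp]
theorem complexBetti.degCast_degCast {a b c : ℕ} (h : a = b) (h' : b = c) (x : complexBetti X a) :
    complexBetti.degCast X h' (complexBetti.degCast X h x) = complexBetti.degCast X (h.trans h') x := by
  subst h h'
  rfl

/-- The inverse transport is the transport along the symmetric equality. [folklore] -/
theorem complexBetti.degCast_symm {a b : ℕ} (h : a = b) :
    (complexBetti.degCast X h).symm = complexBetti.degCast X h.symm := by
  subst h
  rfl

/-- The iterated Lefschetz operator commutes with degree transport: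
`Lʲ (cast x) = cast (Lʲ x)`. [folklore] -/
theorem lefschetzPow_degCast (η : complexBetti X 2) (j : ℕ) {a b : ℕ} (h : a = b)
    (x : complexBetti X a) :
    lefschetzPow η j b (complexBetti.degCast X h x) =
      complexBetti.degCast X (by rw [h]) (lefschetzPow η j a x) := by
  subst h
  rfl

/-- Equal exponents give equal iterated Lefschetz operators, up to degree transport. [folklore] -/
theorem lefschetzPow_congr_exponent (η : complexBetti X 2) {j j' : ℕ} (hj : j = j') (a : ℕ)
    (x : complexBetti X a) :
    lefschetzPow η j a x = complexBetti.degCast X (by rw [hj]) (lefschetzPow η j' a x) := by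
  subst hj
  rfl

/-! ### Polarisation classes -/

/-- A **polarisation class** of the `n`-dimensional smooth projective complex variety `X` (the class
`η = c₁(𝓛_X) ∈ H²(X)` "d'un faisceau inversible ample" of André 1996 §1.1, i.e. the class `[H]` of a
hyperplane section, rendered by its three properties on the real carrier `H²(X(ℂ); ℂ)` exactly as in
the tree's `HardLefschetzThreefold`): `η` is a rational class (`[H] ∈ H²(X, ℤ)`, Voisin I §7.1.2,
§11.1.2), it is supported on a divisor (`η ∈ N¹ H²(X(ℂ); ℂ) = algebraicClasses X 1`: "the class `[Z]`
of a cycle `Z` vanishes on `X – Supp Z`", Voisin II proof of Lemma 9.18), and it has the hard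
Lefschetz property in dimension `n` ("pour tout `i ≤ d`, `L^{d-i} : Hⁱ(X) → H^{2d-i}(X)` est un
isomorphisme", André §1.1; Voisin I Thm. 6.25 with Rem. 6.27 for `[H]`). A priori wider than "class
of an ample sheaf" (module docstring); every consequence drawn on this layer is insensitive to the
difference. [cite: Andre1996Motifs, §1.1 (p. 10)] [cite: VoisinHodgeI2002, Thm. 6.25, Rem. 6.27 and §7.1.2]
[cite: VoisinHodgeII2003, proof of Lemma 9.18] -/
structure IsPolarizationClass (n : ℕ) (X : Motives.SchemeOver ℂ) (η : complexBetti X 2) : Prop where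
  /-- `η` is a rational class (`[H]` is integral). [cite: VoisinHodgeI2002, §7.1.2 and §11.1.2] -/
  isRationalClass : IsRationalClass η
  /-- `η` is supported on a divisor: `η ∈ N¹ H²(X(ℂ); ℂ)`. [cite: VoisinHodgeII2003, proof of Lemma 9.18] -/
  mem_algebraicClasses : η ∈ algebraicClasses X 1
  /-- Hard Lefschetz in dimension `n`: `Lʲ : Hᵏ(X(ℂ); ℂ) → H^{k+2j}(X(ℂ); ℂ)` is bijective for
  `k + j = n`. [cite: Andre1996Motifs, §1.1 (p. 10)] [cite: VoisinHodgeI2002, Thm. 6.25 and Rem. 6.27] -/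
  hasHardLefschetz : HasHardLefschetzProperty η n

/-! ### The Lefschetz involution `*_L` -/

/-- **André's Lefschetz involution `*_L : Hᵃ(X(ℂ); ℂ) → Hᵇ(X(ℂ); ℂ)`, `a + b = 2d`**, of a class
`η ∈ H²(X(ℂ); ℂ)` with the hard Lefschetz property in dimension `d` ("l'involution « de Lefschetz »
`*_L`, donnée en chaque degré par l'isomorphisme de Lefschetz ou son inverse"; "`*_{L} = Σᵢ
(L^{d-i})^{±1} πⁱ`"): on `Hᵃ` with `a ≤ d` it is `L^{d-a} : Hᵃ → H^{2d-a} = Hᵇ`, and on `Hᵃ` with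
`a > d` (so `b < d`) it is the inverse of the hard-Lefschetz isomorphism `L^{d-b} : Hᵇ → H^{2d-b} = Hᵃ`.
On a Lefschetz component `Lᵏ x_{j-2k}`, `x_{j-2k}` primitive, this is André's
`*_L (Lᵏ x_{j-2k}) = L^{d-j+k} x_{j-2k}` (§1.1), without any sign (Kleiman's `⋆` differs from it by
the sign `(-1)^{i(i+1)/2}` on `Lᵏ Pⁱ`). [cite: Andre1996Motifs, §0.2 (p. 7), §1.1 (p. 10) and §3.2 Remarque (p. 21)] -/
def lefschetzInvolution {η : complexBetti X 2} {d : ℕ} (hL : HasHardLefschetzProperty η d) {a b : ℕ}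
    (hab : a + b = 2 * d) : complexBetti X a →ₗ[ℂ] complexBetti X b :=
  if h : a ≤ d then
    (complexBetti.degCast X (show a + 2 * (d - a) = b by omega)).toLinearMap ∘ₗ lefschetzPow η (d - a) a
  else
    (LinearEquiv.ofBijective (lefschetzPow η (d - b) b) (hL (d - b) b (by omega))).symm.toLinearMap ∘ₗ
      (complexBetti.degCast X (show a = b + 2 * (d - b) by omega)).toLinearMap

variable {η : complexBetti X 2} {d : ℕ}

/-- Below the middle degree `*_L` is the Lefschetz isomorphism: for `a + j = d`,
`*_L = Lʲ : Hᵃ(X(ℂ); ℂ) → H^{a+2j}(X(ℂ); ℂ)` ("donnée en chaque degré par l'isomorphisme de Lefschetz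
ou son inverse"). [cite: Andre1996Motifs, §0.2 (p. 7) and §3.2 Remarque (p. 21)] -/
theorem lefschetzInvolution_apply_of_le (hL : HasHardLefschetzProperty η d) {a j : ℕ} (hj : a + j = d)
    (hab : a + (a + 2 * j) = 2 * d) (x : complexBetti X a) :
    lefschetzInvolution hL hab x = lefschetzPow η j a x := by
  unfold lefschetzInvolution
  rw [dif_pos (by omega)]
  obtain rfl : j = d - a := by omega
  rfl

/-- Above the middle degree `*_L` is the inverse of the Lefschetz isomorphism: for `b + j = d` and
`x ∈ Hᵇ(X(ℂ); ℂ)`, `*_L (Lʲ x) = x` (`*_L : H^{b+2j} → Hᵇ`).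
[cite: Andre1996Motifs, §0.2 (p. 7) and §3.2 Remarque (p. 21)] -/
theorem lefschetzInvolution_lefschetzPow (hL : HasHardLefschetzProperty η d) {b j : ℕ} (hj : b + j = d)
    (hab : b + 2 * j + b = 2 * d) (x : complexBetti X b) :
    lefschetzInvolution hL hab (lefschetzPow η j b x) = x := by
  rcases Nat.eq_zero_or_pos j with rfl | hj0
  · -- `j = 0`: the source degree `b + 2 * 0` is `b = d` and `*_L = L⁰ = id`.
    rw [lefschetzPow_zero, LinearMap.id_apply]
    have h := lefschetzInvolution_apply_of_le hL (a := b + 2 * 0) (j := 0) (by omega) hab x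
    rw [lefschetzPow_zero, LinearMap.id_apply] at h
    exact h
  · unfold lefschetzInvolution
    rw [dif_neg (by omega)]
    obtain rfl : j = d - b := by omega
    exact (LinearEquiv.ofBijective (lefschetzPow η (d - b) b) (hL (d - b) b (by omega))).symm_apply_apply x

/-- Above the middle degree `*_L` is the inverse of the Lefschetz isomorphism: for `b + j = d` and
`y ∈ H^{b+2j}(X(ℂ); ℂ)`, `Lʲ (*_L y) = y`. [cite: Andre1996Motifs, §0.2 (p. 7) and §3.2 Remarque (p. 21)] -/
theorem lefschetzPow_lefschetzInvolution (hL : HasHardLefschetzProperty η d) {b j : ℕ} (hj : b + j = d)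
    (hab : b + 2 * j + b = 2 * d) (y : complexBetti X (b + 2 * j)) :
    lefschetzPow η j b (lefschetzInvolution hL hab y) = y := by
  obtain ⟨x, rfl⟩ := (hL j b hj).2 y
  rw [lefschetzInvolution_lefschetzPow hL hj hab x]

/-- `*_L` below the middle degree followed by `*_L` above it is the identity: for `a + j = d`,
`*_L (*_L x) = x` on `Hᵃ(X(ℂ); ℂ)` (`*_L` is an involution of `H•(X(ℂ); ℂ)`).
[cite: Andre1996Motifs, §1.1 (p. 10)] -/
theorem lefschetzInvolution_lefschetzInvolution_of_le (hL : HasHardLefschetzProperty η d) {a j : ℕ}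
    (hj : a + j = d) (hab : a + (a + 2 * j) = 2 * d) (hba : a + 2 * j + a = 2 * d)
    (x : complexBetti X a) :
    lefschetzInvolution hL hba (lefschetzInvolution hL hab x) = x := by
  rw [lefschetzInvolution_apply_of_le hL hj hab x, lefschetzInvolution_lefschetzPow hL hj hba x]

/-- `*_L` above the middle degree followed by `*_L` below it is the identity: for `b + j = d`,
`*_L (*_L y) = y` on `H^{b+2j}(X(ℂ); ℂ)`. [cite: Andre1996Motifs, §1.1 (p. 10)] -/
theorem lefschetzInvolution_lefschetzInvolution_of_ge (hL : HasHardLefschetzProperty η d) {b j : ℕ}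
    (hj : b + j = d) (hab : b + 2 * j + b = 2 * d) (hba : b + (b + 2 * j) = 2 * d)
    (y : complexBetti X (b + 2 * j)) :
    lefschetzInvolution hL hba (lefschetzInvolution hL hab y) = y := by
  rw [lefschetzInvolution_apply_of_le hL hj hba, lefschetzPow_lefschetzInvolution hL hj hab y]

/-- `*_L : Hᵃ(X(ℂ); ℂ) → Hᵇ(X(ℂ); ℂ)` is bijective (degreewise the Lefschetz isomorphism or its
inverse). [cite: Andre1996Motifs, §0.2 (p. 7)] -/
theorem lefschetzInvolution_bijective (hL : HasHardLefschetzProperty η d) {a b : ℕ}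
    (hab : a + b = 2 * d) : Function.Bijective (lefschetzInvolution hL hab) := by
  unfold lefschetzInvolution
  split_ifs with h
  · exact (complexBetti.degCast X _).bijective.comp (hL (d - a) a (by omega))
  · exact (LinearEquiv.ofBijective (lefschetzPow η (d - b) b) (hL (d - b) b (by omega))).symm.bijective.comp
      (complexBetti.degCast X _).bijective

/-! ### Grothendieck's form `A(X)` of the standard conjecture of Lefschetz type -/

/-- OPEN CONJECTURE — **standard conjecture of Lefschetz type, Grothendieck's form `A(X)`**, on the
real carriers `H•(X(ℂ); ℂ)` [status: open] (Grothendieck, Bombay 1968, §3 p. 196; the tree's abstract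
rendering over a Weil cohomology theory is `Motives.WeilCohomology.StandardConjectureA`): for `X`
smooth projective of dimension `n` over `ℂ` with polarisation class `η` (Grothendieck's hyperplane
class `ξ`), (a) *(the mild form)* `Lʳ = (η ∪ ·)ʳ : Hⁱ(X(ℂ); ℂ) → H²ⁿ⁻ⁱ(X(ℂ); ℂ)`, `i + r = n`, is an
isomorphism — on this carrier the hard Lefschetz THEOREM for a hyperplane class (Voisin I Thm. 6.25),
i.e. the `(η, n)`-instance of `HasHardLefschetzProperty` — and (b) for `i = 2p`, `Lʳ` "induces an
isomorphism (or equivalently, an epimorphism) `Cᵖ(X) → Cⁿ⁻ᵖ(X)`" of the spaces of algebraic classes,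
here their `ℂ`-spans `Cᵖ(X) ⊗ ℂ = algebraicClasses X p = Nᵖ H²ᵖ` (written `2p + r = n`, `p + r = q`,
the target `algebraicClasses X q` in the degree spelling `supportedClasses X (2p + 2r) q`; for the
`ℂ`-spans "bijective" and "surjective" are again equivalent, `Lʳ` being injective by (a), and the
statement for `ℂ`-spans is equivalent to Grothendieck's for the finite-dimensional `ℚ`-spaces `Cᵖ(X)`,
`Lʳ` being defined over `ℚ`). Equivalent to `B(X)` for all `X` ("`B(X) ⇒ A(X)`", "`A(X × X) ⇒ B(X)`",
loc. cit.); open ("still unknown even in the complex case" beyond the classical examples). A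
per-`(X, η)` predicate; no `_holds` theorem can exist short of settling the conjecture.
[cite: Grothendieck1968, §3 p. 196 (A(X))] -/
def StandardConjectureA (n : ℕ) (X : Motives.SchemeOver ℂ) (η : complexBetti X 2) : Prop :=
  HasHardLefschetzProperty η n ∧
    ∀ (p r q : ℕ), 2 * p + r = n → p + r = q →
      Set.BijOn (lefschetzPow η r (2 * p)) (algebraicClasses X p : Set (complexBetti X (2 * p)))
        (supportedClasses X (2 * p + 2 * r) q)

/-- Clause (a) of `A(X)` is the hard Lefschetz property of `η` (unfolding).
[cite: Grothendieck1968, §3 p. 196 (A(X))] -/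
theorem StandardConjectureA.hasHardLefschetz {n : ℕ} {η : complexBetti X 2}
    (h : StandardConjectureA n X η) : HasHardLefschetzProperty η n :=
  h.1

/-- Clause (b) of `A(X)`, surjectivity half: for `2p + r = n`, every algebraic class of codimension
`q = p + r = n - p` is `Lʳ` of an algebraic class of codimension `p` ("or equivalently, an
epimorphism"). [cite: Grothendieck1968, §3 p. 196 (A(X))] -/
theorem StandardConjectureA.exists_eq_lefschetzPow {n : ℕ} {η : complexBetti X 2}
    (h : StandardConjectureA n X η) {p r q : ℕ} (hpr : 2 * p + r = n) (hq : p + r = q)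
    {y : complexBetti X (2 * p + 2 * r)} (hy : y ∈ supportedClasses X (2 * p + 2 * r) q) :
    ∃ x ∈ algebraicClasses X p, lefschetzPow η r (2 * p) x = y :=
  (h.2 p r q hpr hq).surjOn hy

/-! ### The action of a cohomology class of `W ⊗ X` as a correspondence, relative to orientations -/

section Correspondences

variable {m n : ℕ} {W X : Motives.SchemeOver ℂ}

/-- **The action `γ^* : Hᵃ(X(ℂ); ℂ) → Hᵇ(W(ℂ); ℂ)` of a class `γ ∈ H^{2e}((W ⊗ X)(ℂ); ℂ)` as a
correspondence**, `γ^*(c) = pr_{W*}(pr_X^* c ∪ γ)`, `a + 2e = b + 2 dim X` (Voisin II (10.7):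
"`α_r^*(β) = pr_{1*}(pr_2^*(β) ∪ α)`"; the Künneth-component morphisms of Voisin I, Lemma 11.41; the
FIRST factor receives), CONSTRUCTED on the real carriers relative to `ℂ`-orientations `μ` of the
closed `2(m+n)`-manifold `(W ⊗ X)(ℂ)` and `ν` of the closed `2m`-manifold `W(ℂ)` (`dim W = m`,
`dim X = n`): the push-forward `pr_{W*}` is the tree's topological Gysin homomorphism
`gysinMap μ ν pr_W(ℂ) = D_ν⁻¹ ∘ pr_W(ℂ)_* ∘ D_μ` through `H_q`, `b + q = 2m`
(`AlgebraicTopology/SingularHomology/GysinMap`; Fulton, *Young Tableaux* App. B (5); Poincaré duality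
`D_ν` bijective for the closed oriented manifold `W(ℂ)`, Hatcher Thm. 3.30, the tree's
`bijective_poincareDualityMap`). This is the tree's `GysinFormalism.corrClassGen` (file
`GysinFormalismCorrespondences`) with the hypothesis-structure Gysin morphism replaced by the
constructed one. Intended orientations: the complex ones; for `W`, `W ⊗ X` smooth projective
(connected) every `ℂ`-orientation is a non-zero complex multiple of the complex orientation, under
which `γ^*` changes by a non-zero scalar only (see `IsAlgebraicCorrespondence`).
[cite: VoisinHodgeII2003, proof of Thm. 10.17 (10.7)] [cite: VoisinHodgeI2002, §11.3.3 Lemma 11.41]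
[cite: FultonYoungTableaux1997, Appendix B §B.1 (5)] -/
def corrClassAction (μ : HomologicalOrientation ℂ (Motives.ComplexPoints (W ⊗ X)) (2 * (m + n)))
    (ν : HomologicalOrientation ℂ (Motives.ComplexPoints W) (2 * m)) {e a b q : ℕ}
    (hab : a + 2 * e = b + 2 * n) (hq : b + q = 2 * m) :
    complexBetti (W ⊗ X) (2 * e) →ₗ[ℂ] complexBetti X a →ₗ[ℂ] complexBetti W b :=
  (LinearMap.llcomp ℂ (complexBetti X a) (complexBetti (W ⊗ X) (a + 2 * e)) (complexBetti W b)
      (gysinMap μ ν (Motives.AlgPoints.mapContinuous (L := ℂ) (fst W X))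
        (show a + 2 * e + q = 2 * (m + n) by omega) hq)) ∘ₗ
    (LinearMap.lcomp ℂ (complexBetti (W ⊗ X) (a + 2 * e)) (complexBetti.map (snd W X) a).hom) ∘ₗ
    (cupProduct (rfl : a + 2 * e = a + 2 * e)).flip

/-- Unfolding of `corrClassAction`: `γ^*(c) = pr_{W*}(pr_X^* c ∪ γ)` with
`pr_{W*} = gysinMap μ ν pr_W(ℂ)`. [cite: VoisinHodgeII2003, proof of Thm. 10.17 (10.7)] -/
theorem corrClassAction_apply (μ : HomologicalOrientation ℂ (Motives.ComplexPoints (W ⊗ X)) (2 * (m + n)))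
    (ν : HomologicalOrientation ℂ (Motives.ComplexPoints W) (2 * m)) {e a b q : ℕ}
    (hab : a + 2 * e = b + 2 * n) (hq : b + q = 2 * m) (γ : complexBetti (W ⊗ X) (2 * e))
    (c : complexBetti X a) :
    corrClassAction μ ν hab hq γ c =
      gysinMap μ ν (Motives.AlgPoints.mapContinuous (L := ℂ) (fst W X))
        (show a + 2 * e + q = 2 * (m + n) by omega) hq
        (cupProduct (rfl : a + 2 * e = a + 2 * e) (complexBetti.map (snd W X) a c) γ) :=
  rfl

variable (m n W X) in
/-- A linear map `T : Hᵃ(X(ℂ); ℂ) → Hᵇ(W(ℂ); ℂ)` (`dim W = m`, `dim X = n`) **is induced by an algebraic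
correspondence** ("donnée par une correspondance algébrique", André 1996 §2.1; Kleiman/Grothendieck:
an "algebraic" operator): for some `ℂ`-orientations `μ` of `(W ⊗ X)(ℂ)` and `ν` of `W(ℂ)` satisfying
Poincaré duality and some algebraic class `γ ∈ Nᵉ H^{2e}((W ⊗ X)(ℂ); ℂ) = algebraicClasses (W ⊗ X) e`
(the `ℂ`-span of the classes of codimension-`e` cycles on `W × X`), `T = γ^* = pr_{W*}(pr_X^* (·) ∪ γ)`
(`corrClassAction`). Independent of the orientations used: for `W`, `W ⊗ X` smooth projective the
manifolds `W(ℂ)`, `(W ⊗ X)(ℂ)` are connected, any two `ℂ`-orientations of either differ by a non-zero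
complex constant, `γ^*` then changes by a non-zero scalar, and `algebraicClasses (W ⊗ X) e` is a
`ℂ`-subspace. [cite: Andre1996Motifs, §2.1 remark following Déf. 1 (p. 14)]
[cite: VoisinHodgeII2003, proof of Thm. 10.17 (10.7)] -/
def IsAlgebraicCorrespondence {a b : ℕ} (T : complexBetti X a →ₗ[ℂ] complexBetti W b) : Prop :=
  ∃ (μ : HomologicalOrientation ℂ (Motives.ComplexPoints (W ⊗ X)) (2 * (m + n)))
    (ν : HomologicalOrientation ℂ (Motives.ComplexPoints W) (2 * m))
    (_ : μ.HasPoincareDuality) (_ : ν.HasPoincareDuality) (e q : ℕ) (hab : a + 2 * e = b + 2 * n)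
    (hq : b + q = 2 * m) (γ : complexBetti (W ⊗ X) (2 * e)),
    γ ∈ algebraicClasses (W ⊗ X) e ∧ corrClassAction μ ν hab hq γ = T

end Correspondences

/-! ### The standard conjecture of Lefschetz type in André's `⋆_L`-form -/

/-- OPEN CONJECTURE — **standard conjecture of Lefschetz type `B(X)`, in the form "the Lefschetz
involution `*_L` is given by an algebraic correspondence"**, on the real carriers [status: open]:
for `X` smooth projective of dimension `n` over `ℂ` and a polarisation class `η`, in every degree
`*_L : Hᵃ(X(ℂ); ℂ) → Hᵇ(X(ℂ); ℂ)` (`a + b = 2n`, `lefschetzInvolution`) is induced by an algebraic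
class on `X × X` (`IsAlgebraicCorrespondence`). This is the hypothesis under which André's motivated
cycles reduce to algebraic cycles ("cette notion se réduit à celle de cycle algébrique si pour tout
objet de `𝒱` l'involution `*_L` est donnée par une correspondance algébrique", §0.3; "l'idée clé de
cet article est d'adjoindre formellement cette involution aux correspondances algébriques", §0.2),
and it is Grothendieck's `B(X)` ("the `Λ`-operation of Hodge theory is algebraic", Bombay 1968 §3
p. 196): `ℚ[L, *_L] = ℚ[L, Λ]` (André Prop. 1.2), so with `L` algebraic, `*_L` is algebraic iff `Λ` is.
Open exactly as `StandardConjectureA` ("`B(X) ⇒ A(X)`", "`A(X × X) ⇒ B(X)`"); known classically for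
curves, surfaces, abelian varieties, flag varieties, complete intersections. A per-`(X, η)` predicate
(vacuous for `η` not a polarisation class); no `_holds` theorem can exist short of settling the
conjecture. [cite: Andre1996Motifs, §0.2–0.3 (pp. 7–8) and Prop. 1.2 (p. 11)]
[cite: Grothendieck1968, §3 p. 196 (B(X))] -/
def StandardConjectureBStar (n : ℕ) (X : Motives.SchemeOver ℂ) (η : complexBetti X 2) : Prop :=
  ∀ (hη : IsPolarizationClass n X η) (a b : ℕ) (hab : a + b = 2 * n),
    IsAlgebraicCorrespondence n n X X (lefschetzInvolution hη.hasHardLefschetz hab)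

/-! ### Motivated classes (André 1996, Déf. 1) -/

section Motivated

variable {n : ℕ} {X : Motives.SchemeOver ℂ}

variable (n X) in
/-- A class `x ∈ H²ᵖ(X(ℂ); ℂ)` (`X` smooth projective of dimension `n` over `ℂ`) **is a motivated
class** in the sense of André 1996, Déf. 1 ("Un cycle motivé sur `X` à coefficients dans `E` est un
élément de `H(X)` de la forme `pr^{XY}_{X*}(α ∪ * β)`, où `α` et `β` sont des cycles algébriques à
coefficients dans `E` sur `X × Y`, avec `Y` arbitraire dans `𝒱`, `* = *_{X×Y}` est relative à
`η_{X×Y}`"), on the real carriers and with `E = ℂ`: there are a smooth projective `Y` of dimension `m`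
(the auxiliary "pièce de base"; `𝒱` = all smooth projective complex varieties, the maximal choice),
a polarisation class `η` of the `(n+m)`-dimensional `X ⊗ Y` (`IsPolarizationClass`), `ℂ`-orientations
`μ` of `(X ⊗ Y)(ℂ)` and `ν` of `X(ℂ)` satisfying Poincaré duality, and algebraic classes
`α ∈ Nᵃ H²ᵃ((X ⊗ Y)(ℂ); ℂ)`, `β ∈ Nᵇ H²ᵇ((X ⊗ Y)(ℂ); ℂ)` (`algebraicClasses`, the `ℂ`-spans of cycle
classes), with `b + b' = n + m`, `a + b' = p + m`, `p + q = n`, such that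
`x = pr_{X*}(α ∪ *_L β)`, where `*_L : H²ᵇ → H^{2b'}` is the Lefschetz involution of `η`
(`lefschetzInvolution`) and `pr_{X*} : H^{2(p+m)}((X ⊗ Y)(ℂ)) → H²ᵖ(X(ℂ))` is the Gysin homomorphism
`gysinMap μ ν pr_X(ℂ)` (through `H_{2q}`).

Faithfulness. (i) André polarises `X × Y` by the product class `[X] ⊗ η_Y + η_X ⊗ [Y]` of ample
classes; here `η` is any polarisation class of `X ⊗ Y` — by §3.2 Remarque (with Prop. 1.2) the
Lefschetz involution of any other polarisation is a motivated correspondence, so the SPAN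
`motivatedClasses` is unchanged (for the product classes themselves hard Lefschetz on `X ⊗ Y` is the
`𝔰𝔩₂`-equivariance of Künneth, §1.3). (ii) The orientations: for the connected closed manifolds
`X(ℂ)`, `(X ⊗ Y)(ℂ)` every `ℂ`-orientation is a non-zero complex multiple of the complex one, so each
generator here is a non-zero multiple of one of André's and conversely — again the same span.
(iii) `Y` connected (the tree's `IsSmoothProjective` includes geometric irreducibility) instead of
André's disjoint unions: a generator with `Y = Y₁ ⊔ Y₂` is the sum of the two generators with `Y₁`
and `Y₂` — same span. (iv) `E = ℂ`, `A(X × Y)` rendered as the coniveau spaces `Nᵃ H²ᵃ` = `ℂ`-spans of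
cycle classes (the standing identification of `HodgeTheory/AlgebraicClasses`, by purity).
[cite: Andre1996Motifs, §2.1 Déf. 1 (p. 14)] -/
def IsMotivatedClass (p : ℕ) (x : complexBetti X (2 * p)) : Prop :=
  ∃ (m : ℕ) (Y : Motives.SchemeOver ℂ) (_ : Motives.IsSmoothProjective m Y)
    (μ : HomologicalOrientation ℂ (Motives.ComplexPoints (X ⊗ Y)) (2 * (n + m)))
    (ν : HomologicalOrientation ℂ (Motives.ComplexPoints X) (2 * n))
    (_ : μ.HasPoincareDuality) (_ : ν.HasPoincareDuality)
    (η : complexBetti (X ⊗ Y) 2) (hη : IsPolarizationClass (n + m) (X ⊗ Y) η)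
    (a b b' q : ℕ) (hbb' : b + b' = n + m) (hab : a + b' = p + m) (hq : p + q = n)
    (α : complexBetti (X ⊗ Y) (2 * a)) (β : complexBetti (X ⊗ Y) (2 * b)),
    α ∈ algebraicClasses (X ⊗ Y) a ∧ β ∈ algebraicClasses (X ⊗ Y) b ∧
      x = gysinMap μ ν (Motives.AlgPoints.mapContinuous (L := ℂ) (fst X Y))
            (show 2 * (p + m) + 2 * q = 2 * (n + m) by omega) (show 2 * p + 2 * q = 2 * n by omega)
            (cupProduct (show 2 * a + 2 * b' = 2 * (p + m) by omega) α
              (lefschetzInvolution hη.hasHardLefschetz (show 2 * b + 2 * b' = 2 * (n + m) by omega) β))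

variable (n X) in
/-- The `ℂ`-subspace **`A_motᵖ(X)_ℂ ⊆ H²ᵖ(X(ℂ); ℂ)` of motivated classes** (André 1996, Déf. 1 with
`E = F = ℂ` for the classical cohomology `H_B(–, ℚ) ⊗ ℂ`, §2.5 c)): the span of the classes
`pr_{X*}(α ∪ *_L β)` (`IsMotivatedClass`). André defines `A_mot(X)_E` as the SET of such classes and
proves it is a sub-`E`-algebra (Prop. 2.1 (i)); the span is taken here so that the definition is a
`Submodule` without that theorem. By Prop. 3.2.1 and Prop. 3.3 (`Q = ℚ` for Betti cohomology),
`A_mot(X)_ℂ = A_mot(X)_ℚ ⊗ ℂ`; motivated classes are absolute Hodge, in particular rational Hodge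
classes span it (Prop. 2.5.1). The real-carrier counterpart of the tree's abstract
`Motives.WeilCohomology.motivatedClasses` (file `Motives/MotivatedCycles`).
[cite: Andre1996Motifs, §2.1 Déf. 1 and Prop. 2.1 (p. 14)] -/
def motivatedClasses (p : ℕ) : Submodule ℂ (complexBetti X (2 * p)) :=
  Submodule.span ℂ {x | IsMotivatedClass n X p x}

/-- **The generators** (constructor form of `IsMotivatedClass`): for `Y` smooth projective of
dimension `m`, orientations `μ`, `ν` with Poincaré duality, a polarisation class `η` of `X ⊗ Y` and
algebraic `α ∈ Nᵃ H²ᵃ`, `β ∈ Nᵇ H²ᵇ` on `X ⊗ Y` (`b + b' = n + m`, `a + b' = p + m`, `p + q = n`), the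
class `pr_{X*}(α ∪ *_L β) ∈ H²ᵖ(X(ℂ); ℂ)` is motivated. [cite: Andre1996Motifs, §2.1 Déf. 1 (p. 14)] -/
theorem isMotivatedClass_gysinMap {p m : ℕ} {Y : Motives.SchemeOver ℂ} (hY : Motives.IsSmoothProjective m Y)
    (μ : HomologicalOrientation ℂ (Motives.ComplexPoints (X ⊗ Y)) (2 * (n + m)))
    (ν : HomologicalOrientation ℂ (Motives.ComplexPoints X) (2 * n)) (hμ : μ.HasPoincareDuality)
    (hν : ν.HasPoincareDuality) {η : complexBetti (X ⊗ Y) 2} (hη : IsPolarizationClass (n + m) (X ⊗ Y) η)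
    {a b b' q : ℕ} (hbb' : b + b' = n + m) (hab : a + b' = p + m) (hq : p + q = n)
    {α : complexBetti (X ⊗ Y) (2 * a)} {β : complexBetti (X ⊗ Y) (2 * b)}
    (hα : α ∈ algebraicClasses (X ⊗ Y) a) (hβ : β ∈ algebraicClasses (X ⊗ Y) b) :
    IsMotivatedClass n X p
      (gysinMap μ ν (Motives.AlgPoints.mapContinuous (L := ℂ) (fst X Y))
        (show 2 * (p + m) + 2 * q = 2 * (n + m) by omega) (show 2 * p + 2 * q = 2 * n by omega)
        (cupProduct (show 2 * a + 2 * b' = 2 * (p + m) by omega) α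
          (lefschetzInvolution hη.hasHardLefschetz (show 2 * b + 2 * b' = 2 * (n + m) by omega) β))) :=
  ⟨m, Y, hY, μ, ν, hμ, hν, η, hη, a, b, b', q, hbb', hab, hq, α, β, hα, hβ, rfl⟩

/-- A motivated class lies in `motivatedClasses` (the span of the generators). [folklore] -/
theorem IsMotivatedClass.mem_motivatedClasses {p : ℕ} {x : complexBetti X (2 * p)}
    (hx : IsMotivatedClass n X p x) : x ∈ motivatedClasses n X p :=
  Submodule.subset_span hx

/-- `motivatedClasses` is the smallest subspace containing the generators: it is contained in any
subspace containing every motivated class. [folklore] -/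
theorem motivatedClasses_le_iff {p : ℕ} {V : Submodule ℂ (complexBetti X (2 * p))} :
    motivatedClasses n X p ≤ V ↔ ∀ x, IsMotivatedClass n X p x → x ∈ V :=
  Submodule.span_le

/-- There are no generators above the top degree: for `p > n = dim X` no class of `H²ᵖ(X(ℂ); ℂ)` is a
generator (the push-forward lands in degree `2p = 2n - 2q ≤ 2n`), so `A_motᵖ(X)_ℂ = 0` there — as it
must be, `H²ᵖ(X(ℂ); ℂ)` itself being `0` for `p > n`. [folklore] -/
theorem motivatedClasses_eq_bot_of_lt {p : ℕ} (hp : n < p) : motivatedClasses n X p = ⊥ := by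
  rw [motivatedClasses, Submodule.span_eq_bot]
  rintro x ⟨m, Y, -, μ, ν, -, -, η, hη, a, b, b', q, hbb', hab, hq, -⟩
  omega

end Motivated

/-! ### Named facts: André 1996, §2.1 remark, Thm. 0.5, Thm. 0.6.2 -/

section Facts

/-- **Under `B`, motivated classes are algebraic** (André 1996, §2.1, the remark following Déf. 1,
p. 14: "`A_mot(X) = A(X)` si pour tout schéma `Y` dans `𝒱`, polarisé, l'involution de Lefschetz est
donnée par une correspondance algébrique"; §0.3: "cette notion se réduit à celle de cycle algébrique
si pour tout objet de `𝒱` l'involution `*_L` est donnée par une correspondance algébrique"), on the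
real carriers: if for every smooth projective complex `Z` and every polarisation class `η` of `Z` the
Lefschetz involution of `η` is induced by an algebraic correspondence (`StandardConjectureBStar d Z η`,
itself quantified over the polarisation witness; i.e. conjecture `B(Z)` for all `Z`), then `A_motᵖ(X)_ℂ ⊆ Nᵖ H²ᵖ(X(ℂ); ℂ) = algebraicClasses X p` for every
smooth projective `X` and every `p`. (Only the inclusion `⊆` of the printed equality is recorded; the
reverse inclusion "il est clair que `A_mot(X)_E` contient `A(X)`" holds unconditionally and is not a
hypothesis of anything.) In print: `*_L β` is then algebraic, so is `α ∪ *_L β` and its push-forward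
(compatibility of cycle classes with correspondences, products and proper push-forward, Voisin II
Prop. 9.20–9.21). [cite: Andre1996Motifs, §2.1 remark following Déf. 1 (p. 14) and §0.3 (pp. 7–8)]
[cite: VoisinHodgeII2003, Prop. 9.20 and Prop. 9.21] -/
def Andre1996_motivatedClasses_le_algebraicClasses_of_standardConjectureB : Prop :=
  (∀ (d : ℕ) (Z : Motives.SchemeOver ℂ) (η : complexBetti Z 2), Motives.IsSmoothProjective d Z →
      StandardConjectureBStar d Z η) →
    ∀ ⦃n : ℕ⦄ ⦃X : Motives.SchemeOver ℂ⦄, Motives.IsSmoothProjective n X → ∀ p : ℕ,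
      motivatedClasses n X p ≤ algebraicClasses X p

/-- **André's deformation theorem** (André 1996, Théorème de déformation 0.5: "Soient `S` un schéma
réduit connexe de type fini sur `ℂ`, `f : 𝒳 → S` un morphisme projectif et lisse, et `ξ` une section
du faisceau `R²ᵖ f_* ℚ_𝒳(p)` sur l'analytisé de `S`. Alors si en un point `s ∈ S(ℂ)`, la fibre `ξ_s`
est motivée, il en est de même en tout point `t ∈ S(ℂ)` (pour un choix convenable de pièces de
base)."), in GLOBAL-CLASS FORM on the real carriers: for `f : 𝒳 ⟶ S` a smooth projective family of
relative dimension `n` (`Motives.IsSmoothProjectiveFamily`: smooth of relative dimension `n`, proper,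
fibres smooth projective varieties) which is projective in Hartshorne's sense (`f` factors through a
closed immersion into `ℙᴺ × S`), over a reduced, connected `ℂ`-scheme of finite type `S`, and a class
`A ∈ H²ᵖ(𝒳(ℂ); ℂ)`: if the restriction `A|_{𝒳_{s₀}}` is motivated for ONE complex point `s₀` then
`A|_{𝒳_s}` is motivated for EVERY complex point `s`. This is implied by the printed statement: the
restrictions of a global rational class form a section of `R²ᵖ f_* ℚ` over `S^an`, and a complex
global class is a `ℂ`-combination `Σ cᵢ Aᵢ` of rational ones with `ℚ`-linearly independent `cᵢ`, for
which `Σ cᵢ Aᵢ|_s ∈ A_mot(𝒳_s)_ℚ ⊗ ℂ` forces each `Aᵢ|_s ∈ A_mot(𝒳_s)_ℚ`; conversely every global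
section of `R²ᵖ f_* ℚ` over the connected `S^an` is the restriction of a global class (Deligne's
theorem of the fixed part, Hodge II 4.1.1, the engine of André's proof). "Pièces de base": all smooth
projective complex varieties (the maximal choice). [cite: Andre1996Motifs, Thm. 0.5 (p. 8) and §5.1 (p. 25)] -/
def Andre1996_deformation : Prop :=
  ∀ ⦃n : ℕ⦄ ⦃𝒳 S : Motives.SchemeOver ℂ⦄ (f : 𝒳 ⟶ S), Motives.IsSmoothProjectiveFamily f n →
    (∃ (N : ℕ) (ι : 𝒳 ⟶ Motives.projectiveSpace N ℂ ⊗ S),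
        IsClosedImmersion ι.left ∧ ι ≫ snd (Motives.projectiveSpace N ℂ) S = f) →
    IsReduced S.left → ConnectedSpace S.left → LocallyOfFiniteType S.hom → QuasiCompact S.hom →
    ∀ (p : ℕ) (A : complexBetti 𝒳 (2 * p)) (s₀ : Motives.ComplexPoints S),
      complexBetti.map (Motives.fiberι f s₀) (2 * p) A ∈ motivatedClasses n (Motives.fiberOver f s₀) p →
      ∀ s : Motives.ComplexPoints S,
        complexBetti.map (Motives.fiberι f s) (2 * p) A ∈ motivatedClasses n (Motives.fiberOver f s) p

/-- **Hodge classes on abelian varieties are motivated** (André 1996, Théorème 0.6.2: "Tout cycle de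
Hodge `ξ` sur une variété abélienne `A` est motivé. Plus précisément, `ξ` est somme de cycles de la
forme `p_*(α ∪ *_L(β))`, où `α` et `β` sont des `ℚ`-cycles algébriques sur `A × B × Y₁ × ⋯ × Y_k`, `B`
désignant une variété abélienne, `Yᵢ` l'espace total d'un pinceau compact de variétés abéliennes, et
`p` la projection sur `A`"; §6.3: "Le cas où `K = ℂ` […] tout élément `ξ` de type `(0,0)` dans
`H²ᵖ_B(A, ℚ)(p)` est motivé"), on the real carriers: for a complex abelian variety `A` (the tree's
`Motives.AbelianVariety ℂ`, of dimension `A.dim`, with smooth-projectivity witness `hA`, always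
available as `Motives.AbelianVariety.isSmoothProjective_holds`), every rational class of Hodge type
`(p, p)` in `H²ᵖ(A(ℂ); ℂ)` lies in `A_motᵖ(A)_ℂ`. The auxiliary varieties `B × Y₁ × ⋯ × Y_k` of the
finer statement are smooth projective, so the printed statement implies this one (which allows any
smooth projective auxiliary `Y`). The real-carrier counterpart of the `B`-parametrised predicate
`Literature.Barriers.HodgeConjecture.Andre1996_hodgeClassesOnAbelianVarieties_motivated B` (barrier
catalogue), which is not a closed statement. [cite: Andre1996Motifs, Thm. 0.6.2 (p. 9) and §6.3 (p. 31)] -/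
def Andre1996_hodgeClasses_abelianVariety_motivated : Prop :=
  ∀ (A : Motives.AbelianVariety ℂ) (_ : Motives.IsSmoothProjective A.dim A.X) (p : ℕ)
    (c : complexBetti A.X (2 * p)), IsRationalClass c → IsOfHodgeType A.dim A.X (2 * p) p p c →
      c ∈ motivatedClasses A.dim A.X p

end Facts

end HodgeTheory

end Literature.AlgebraicGeometry.HodgeTheory

end
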